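import Summits.CriticalPhenomena.PercolationContinuityZ3.Theorems.PercNearOneGluingNoHeavyLowerTailThreePointGammaCombStates
import HarnessLib

/-!
# `NoHeavyLowerTail` (stmt-CriticalPhenomena-4575) — comb positivity of `Γ`, II: COMPLETE MONOTONICITY of the Γ-certificate (GAMMA-COMB-THEOREM.md §2–3)

Support file (prover prim-ineq-gen-2 gen 5; `--supports stmt-CriticalPhenomena-4575`).  Small technical definitions, no named facts, no sorries.
With `F = −gcert = [λ₃ fires] − [λ₄ fires]` (prim-lit-2 PROOF-GAMMA) and a base `(X,Y,Z)` with a set `M` of pairs closed in all three copies, the signed sum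
`D_M F = Σ_{κ ∈ Asg M} sgn κ · F(X ∪ κ₁, Y ∪ κ₂, Z ∪ κ₃)` is `≥ 0` (`gcert_complete_monotone`).  At diagonal bases `(O,O,O)` these sums are exactly the
tensor-Bernstein coefficients of `Γ` (= prim-ineq-gen-2's weight-free interval splits `S(O,O∪M)`, ttrl2 census line 489), so `Γ` is COMB-POSITIVE;
`|M| = 1` is `…EdgePolar.gamP_edge_polar`.  Proof: split `F = G − H` into the `λ₃`/`λ₄` halves (`gqG`, `gqH`); by part I each signed sum is a plain sum over
FIXED states (the toggles are invisible to the respective half by the read table of `Φ₃, Φ₄`); the map `bmap` moving the `AB`-bridges from copy `1` to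
copy `2` sends `H`-fixed states injectively to `G`-fixed states with `H(κ) ≤ G(bmap κ)` (Lemma 2 = `gcert_nonpos`, then monotonicity of `λ₃` in `o₃`).
-/

noncomputable section

namespace Summit.CriticalPhenomena.PercolationContinuityZ3.Theorems

namespace ThreePointGamma

open Finset Literature.Probability.Percolation Literature.Probability.Percolation.DecisionTree
open Literature.Probability.Percolation.Gladkov ThreePointLB
open scoped Classical

variable {V : Type*} [Fintype V] [DecidableEq V]

section Pieces

variable (D : Finset (Sym2 V)) (a b c : V)

/-- The `λ₃` half of the certificate (a function of `o₂, o₃`), with the sign removed. [this work] -/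
def gqG (o₂ o₃ : Finset (Sym2 V)) : ℝ :=
  pind (o₂ ∈ Qe a b c ∧ o₃ ∈ conn a c) + pind (o₂ ∈ Qe a b c ∩ (sepEv D a b c)ᶜ ∧ o₃ ∈ conn b c ∩ (conn a b)ᶜ)

/-- The `λ₄` half of the certificate (a function of `o₂′, o₃′`). [this work] -/
def gqH (o₂' o₃' : Finset (Sym2 V)) : ℝ :=
  pind (o₂' ∈ conn a c ∩ (conn a b)ᶜ ∧ o₃' ∈ conn b c ∩ (conn a b)ᶜ)
  + pind (o₂' ∈ (conn a c)ᶜ ∩ (conn b c)ᶜ ∧ o₃' ∈ conn b c ∩ (conn a b)ᶜ)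
  + pind (o₂' ∈ (conn a c)ᶜ ∩ (conn b c)ᶜ ∧ o₃' ∈ conn a c ∩ (conn a b)ᶜ)
  + pind (o₂' ∈ (conn a b ∩ conn a c) ∩ pivEv a b c ∧ o₃' ∈ conn b c ∩ (conn a b)ᶜ)

/-- `gq = gqH − gqG`. [this work] -/
theorem gq_eq_sub (o₂ o₃ o₂' o₃' : Finset (Sym2 V)) : gq D a b c o₂ o₃ o₂' o₃' = gqH a b c o₂' o₃' - gqG D a b c o₂ o₃ := by
  unfold gq gqG gqH; ring

/-- `gqG ≥ 0`. [this work] -/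
theorem gqG_nonneg (o₂ o₃ : Finset (Sym2 V)) : 0 ≤ gqG D a b c o₂ o₃ := add_nonneg (pind_nonneg' _) (pind_nonneg' _)

/-- Monotonicity of the `λ₃` half in `o₃` under adding a set of pairs. [this work] -/
theorem gqG_le_union (o₂ o₃ T : Finset (Sym2 V)) : gqG D a b c o₂ o₃ ≤ gqG D a b c o₂ (o₃ ∪ T) := by
  induction T using Finset.induction_on with
  | empty => simp
  | @insert e T _ ih =>
    have h := gq_insert_le (D := D) (a := a) (b := b) (c := c) o₂ (o₃ ∪ T) ∅ ∅ e
    rw [gq_eq_sub, gq_eq_sub] at h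
    rw [union_insert]
    linarith

/-- Lemma 2 of PROOF-GAMMA in halves: `λ₄`-half `≤` `λ₃`-half on every triple inside the support. [this work] -/
theorem gqH_le_gqG (x : Fin 3 → Finset (Sym2 V)) (hx : x 0 ⊆ D) :
    gqH a b c (phi4 a b x 1) (phi4 a b x 2) ≤ gqG D a b c (phi3 a b x 1) (phi3 a b x 2) := by
  have h := gcert_nonpos D a b c x hx; rw [gcert_eq_gq, gq_eq_sub] at h; linarith

end Pieces

section Outs

variable (a b : V)

omit [Fintype V] in
/-- Removing pairs of `F` from the off-part does not change a splice. [folklore] -/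
theorem splice_sdiff_right_of_subset {F K W T : Finset (Sym2 V)} (hT : T ⊆ F) : splice F K (W \ T) = splice F K W := by
  ext i; by_cases hi : i ∈ F
  · rw [mem_splice_of_mem hi, mem_splice_of_mem hi]
  · rw [mem_splice_of_not_mem hi, mem_splice_of_not_mem hi, mem_sdiff]; exact ⟨fun h => h.1, fun h => ⟨h, fun h' => hi (hT h')⟩⟩

omit [Fintype V] in
/-- Adding pairs disjoint from `F` to the off-part adds them to the splice. [folklore] -/
theorem splice_union_right_of_disjoint {F K W T : Finset (Sym2 V)} (hT : ∀ i ∈ T, i ∉ F) : splice F K (W ∪ T) = splice F K W ∪ T := by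
  ext i; rw [mem_union]; by_cases hi : i ∈ F
  · rw [mem_splice_of_mem hi, mem_splice_of_mem hi]; exact ⟨Or.inl, fun h => h.elim id fun h' => absurd hi (hT i h')⟩
  · rw [mem_splice_of_not_mem hi, mem_splice_of_not_mem hi, mem_union]

omit [Fintype V] in
/-- Erasing a pair NOT in `F` from the ON-`F` configuration does not change the splice. [folklore] -/
theorem splice_erase_left_of_not_mem {F K W : Finset (Sym2 V)} {e : Sym2 V} (he : e ∉ F) :
    splice F (K.erase e) W = splice F K W :=
  splice_congr_left (fun i hi => by rw [mem_erase]; exact ⟨fun h => h.2, fun h => ⟨fun h' => he (h' ▸ hi), h⟩⟩) W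

/-- A pair not meeting the cluster of `K.erase e` can be erased without changing the cluster. [folklore] -/
theorem cl_eq_cl_erase_of_not_touch {K : Finset (Sym2 V)} {x : V} {e : Sym2 V} (h : e ∉ touch (cl (K.erase e) x)) :
    cl K x = cl (K.erase e) x := by
  by_cases he : e ∈ K
  · conv_lhs => rw [← insert_erase he]
    exact cl_insert_of_not_mem_touch h
  · rw [erase_eq_of_notMem he]

/-- If `e` meets neither cluster of `K.erase e`, the four read outputs computed from `K` equal those computed from `K.erase e`. [this work] -/
theorem outs_erase_of_not_touch (K W₁ W₂ : Finset (Sym2 V)) (e : Sym2 V)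
    (hA : e ∉ touch (cl (K.erase e) a)) (hB : e ∉ touch (cl (K.erase e) b)) :
    splice (touch (cl K a)) K W₁ = splice (touch (cl (K.erase e) a)) (K.erase e) W₁ ∧
    splice (touch (cl K b) \ touch (cl K a)) K W₂ = splice (touch (cl (K.erase e) b) \ touch (cl (K.erase e) a)) (K.erase e) W₂ ∧
    splice (touch (cl K a) \ touch (cl K b)) K W₁ = splice (touch (cl (K.erase e) a) \ touch (cl (K.erase e) b)) (K.erase e) W₁ ∧
    splice (touch (cl K b)) K W₂ = splice (touch (cl (K.erase e) b)) (K.erase e) W₂ := by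
  have hA' : e ∉ touch (cl (K.erase e) b) \ touch (cl (K.erase e) a) := fun h => hB (mem_sdiff.1 h).1
  have hB' : e ∉ touch (cl (K.erase e) a) \ touch (cl (K.erase e) b) := fun h => hA (mem_sdiff.1 h).1
  rw [cl_eq_cl_erase_of_not_touch hA, cl_eq_cl_erase_of_not_touch hB]
  exact ⟨(splice_erase_left_of_not_mem hA).symm, (splice_erase_left_of_not_mem hA').symm,
    (splice_erase_left_of_not_mem hB').symm, (splice_erase_left_of_not_mem hB).symm⟩

end Outs

section Mono

variable (D : Finset (Sym2 V)) (a b c : V) (X Y Z : Finset (Sym2 V))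

/-- The triple of configurations of a state over the base `(X,Y,Z)`. [this work] -/
def trip (κ : St V) : Fin 3 → Finset (Sym2 V) := ![X ∪ κ.1, Y ∪ κ.2.1, Z ∪ κ.2.2]

/-- The `λ₃`-weight of a state. [this work] -/
def vG (κ : St V) : ℝ := gqG D a b c (phi3 a b (trip X Y Z κ) 1) (phi3 a b (trip X Y Z κ) 2)

/-- The `λ₄`-weight of a state. [this work] -/
def vH (κ : St V) : ℝ := gqH a b c (phi4 a b (trip X Y Z κ) 1) (phi4 a b (trip X Y Z κ) 2)

/-- Read table of `Φ₃`: `Y_e` unread iff `e` meets `A`. [this work] -/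
def uYG (A _B : Finset V) (e : Sym2 V) : Prop := e ∈ touch A
/-- Read table of `Φ₃`: otherwise `Z_e` unread iff `e` meets `B`. [this work] -/
def uZG (_A B : Finset V) (e : Sym2 V) : Prop := e ∈ touch B
/-- Read table of `Φ₄`: `Y_e` unread iff `e` meets `A` but not `B`. [this work] -/
def uYH (A B : Finset V) (e : Sym2 V) : Prop := e ∈ touch A ∧ e ∉ touch B
/-- Read table of `Φ₄`: otherwise `Z_e` unread iff `e` meets `B`. [this work] -/
def uZH (_A B : Finset V) (e : Sym2 V) : Prop := e ∈ touch B

variable {D a b c X Y Z}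

/-- The outputs of `Φ₃` on a state triple. [this work] -/
theorem phi3_trip (κ : St V) :
    phi3 a b (trip X Y Z κ) 1 = splice (touch (cl (X ∪ κ.1) a)) (X ∪ κ.1) (Y ∪ κ.2.1) ∧
    phi3 a b (trip X Y Z κ) 2 = splice (touch (cl (X ∪ κ.1) b) \ touch (cl (X ∪ κ.1) a)) (X ∪ κ.1) (Z ∪ κ.2.2) := by
  unfold trip; exact ⟨phi3_one_vec a b _ _ _, phi3_two_vec a b _ _ _⟩

/-- The outputs of `Φ₄` on a state triple. [this work] -/
theorem phi4_trip (κ : St V) :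
    phi4 a b (trip X Y Z κ) 1 = splice (touch (cl (X ∪ κ.1) a) \ touch (cl (X ∪ κ.1) b)) (X ∪ κ.1) (Y ∪ κ.2.1) ∧
    phi4 a b (trip X Y Z κ) 2 = splice (touch (cl (X ∪ κ.1) b)) (X ∪ κ.1) (Z ∪ κ.2.2) := by
  unfold trip; exact ⟨phi4_one_vec a b _ _ _, phi4_two_vec a b _ _ _⟩

omit [Fintype V] in
/-- `X ∪ S.erase e = (X ∪ S).erase e` for `e ∉ X`. [folklore] -/
theorem union_erase_eq {X S : Finset (Sym2 V)} {e : Sym2 V} (heX : e ∉ X) : X ∪ S.erase e = (X ∪ S).erase e := by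
  ext f
  by_cases hf : f = e
  · subst hf; simp [heX]
  · simp [hf]

omit [Fintype V] in
/-- `W ∪ flip1 e S` and `W ∪ S` differ at most in `e`: one is `insert e` of the other (for `e ∉ W`). [folklore] -/
theorem union_flip1_cases {W S : Finset (Sym2 V)} {e : Sym2 V} (heW : e ∉ W) :
    W ∪ flip1 e S = insert e (W ∪ S) ∨ W ∪ S = insert e (W ∪ flip1 e S) := by
  by_cases heS : e ∈ S
  · right; ext f; by_cases hfe : f = e
    · subst hfe; simp [mem_flip1, heS]
    · simp [mem_flip1, hfe]
  · left; ext f; by_cases hfe : f = e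
    · subst hfe; simp [mem_flip1, heS, heW]
    · simp [mem_flip1, hfe]

omit [Fintype V] in
/-- Two splices whose off-parts differ by a pair of `F` agree. [folklore] -/
theorem splice_eq_of_insert_cases {F K W W' : Finset (Sym2 V)} {e : Sym2 V} (he : e ∈ F)
    (h : W' = insert e W ∨ W = insert e W') : splice F K W' = splice F K W := by
  rcases h with h | h
  · rw [h, splice_insert_right_of_mem he]
  · rw [h, splice_insert_right_of_mem he]

/-- In the "meets neither" branch both state triples have the same four read outputs. [this work] -/
theorem outs_flip_of_nb {κ : St V} {e : Sym2 V} (heX : e ∉ X) (hnb : nb X a b κ e) :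
    let K := X ∪ κ.1; let K' := X ∪ flip1 e κ.1
    splice (touch (cl K' a)) K' (Y ∪ κ.2.1) = splice (touch (cl K a)) K (Y ∪ κ.2.1) ∧
    splice (touch (cl K' b) \ touch (cl K' a)) K' (Z ∪ κ.2.2) = splice (touch (cl K b) \ touch (cl K a)) K (Z ∪ κ.2.2) ∧
    splice (touch (cl K' a) \ touch (cl K' b)) K' (Y ∪ κ.2.1) = splice (touch (cl K a) \ touch (cl K b)) K (Y ∪ κ.2.1) ∧
    splice (touch (cl K' b)) K' (Z ∪ κ.2.2) = splice (touch (cl K b)) K (Z ∪ κ.2.2) := by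
  intro K K'
  unfold nb cA cB at hnb
  rw [union_erase_eq heX] at hnb
  have he1 : K'.erase e = K.erase e := by
    show (X ∪ flip1 e κ.1).erase e = (X ∪ κ.1).erase e
    rw [← union_erase_eq heX, erase_flip1, union_erase_eq heX]
  have hnb1 : e ∉ touch (cl (K'.erase e) a) ∧ e ∉ touch (cl (K'.erase e) b) := by rw [he1]; exact hnb
  have h0 := outs_erase_of_not_touch a b K (Y ∪ κ.2.1) (Z ∪ κ.2.2) e hnb.1 hnb.2
  have h1 := outs_erase_of_not_touch a b K' (Y ∪ κ.2.1) (Z ∪ κ.2.2) e hnb1.1 hnb1.2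
  rw [he1] at h1
  exact ⟨h1.1.trans h0.1.symm, h1.2.1.trans h0.2.1.symm, h1.2.2.1.trans h0.2.2.1.symm, h1.2.2.2.trans h0.2.2.2.symm⟩

/-- **The `λ₃`-weight is invisible to the `Φ₃`-toggles.** [this work] -/
theorem vG_tog {M : Finset (Sym2 V)} (hMX : ∀ e ∈ M, e ∉ X) (hMY : ∀ e ∈ M, e ∉ Y) (hMZ : ∀ e ∈ M, e ∉ Z)
    (κ : St V) (_hκ : κ ∈ Asg M) (e : Sym2 V) (he : e ∈ M) (h : ¬ fixedP uYG uZG X a b κ e) :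
    vG D a b c X Y Z (tog uYG uZG X a b κ e) = vG D a b c X Y Z κ := by
  have heX := hMX e he
  unfold vG
  rw [(phi3_trip κ).1, (phi3_trip κ).2, (phi3_trip (tog uYG uZG X a b κ e)).1, (phi3_trip (tog uYG uZG X a b κ e)).2]
  rcases tog_cases κ e h with ⟨hnb, -, -, ht⟩ | ⟨-, huy, h1, -, ht⟩ | ⟨-, huy, huz, h1, -, ht⟩
  · -- `e` meets neither cluster: both triples reduce to the `e`-erased copy-0 configuration
    rw [ht]; simp only
    have h := outs_flip_of_nb (Y := Y) (Z := Z) heX hnb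
    rw [h.1, h.2.1]
  · -- `Y_e` unread by `o₂` (`e` meets `A`), `o₃` does not involve copy `1`
    rw [ht]; simp only
    have hA : e ∈ touch (cl (X ∪ κ.1) a) := by
      unfold uYG cA at huy; rwa [erase_eq_of_notMem h1] at huy
    rw [splice_eq_of_insert_cases hA (union_flip1_cases (hMY e he))]
  · -- `Z_e` unread by `o₃` (`e` meets `B` but not `A`)
    rw [ht]; simp only
    have hA : e ∉ touch (cl (X ∪ κ.1) a) := by
      unfold uYG cA at huy; rwa [erase_eq_of_notMem h1] at huy
    have hB : e ∈ touch (cl (X ∪ κ.1) b) := by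
      unfold uZG cB at huz; rwa [erase_eq_of_notMem h1] at huz
    rw [splice_eq_of_insert_cases (mem_sdiff.2 ⟨hB, hA⟩) (union_flip1_cases (hMZ e he))]

/-- **The `λ₄`-weight is invisible to the `Φ₄`-toggles.** [this work] -/
theorem vH_tog {M : Finset (Sym2 V)} (hMX : ∀ e ∈ M, e ∉ X) (hMY : ∀ e ∈ M, e ∉ Y) (hMZ : ∀ e ∈ M, e ∉ Z)
    (κ : St V) (_hκ : κ ∈ Asg M) (e : Sym2 V) (he : e ∈ M) (h : ¬ fixedP uYH uZH X a b κ e) :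
    vH a b c X Y Z (tog uYH uZH X a b κ e) = vH a b c X Y Z κ := by
  have heX := hMX e he
  unfold vH
  rw [(phi4_trip κ).1, (phi4_trip κ).2, (phi4_trip (tog uYH uZH X a b κ e)).1, (phi4_trip (tog uYH uZH X a b κ e)).2]
  rcases tog_cases κ e h with ⟨hnb, -, -, ht⟩ | ⟨-, huy, h1, -, ht⟩ | ⟨-, huy, huz, h1, -, ht⟩
  · rw [ht]; simp only
    have h := outs_flip_of_nb (Y := Y) (Z := Z) heX hnb
    rw [h.2.2.1, h.2.2.2]
  · rw [ht]; simp only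
    have hA : e ∈ touch (cl (X ∪ κ.1) a) ∧ e ∉ touch (cl (X ∪ κ.1) b) := by
      unfold uYH cA cB at huy; rwa [erase_eq_of_notMem h1] at huy
    rw [splice_eq_of_insert_cases (mem_sdiff.2 hA) (union_flip1_cases (hMY e he))]
  · rw [ht]; simp only
    have hB : e ∈ touch (cl (X ∪ κ.1) b) := by
      unfold uZH cB at huz; rwa [erase_eq_of_notMem h1] at huz
    rw [splice_eq_of_insert_cases hB (union_flip1_cases (hMZ e he))]

end Mono

section Final

variable (D : Finset (Sym2 V)) (a b c : V) (X Y Z M : Finset (Sym2 V))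

/-- The `AB`-bridges of a state: pairs of `M` not in copy `0` meeting both clusters of `X ∪ S₁`. [this work] -/
def Br (κ : St V) : Finset (Sym2 V) := (M \ κ.1).filter (fun e => e ∈ touch (cl (X ∪ κ.1) a) ∧ e ∈ touch (cl (X ∪ κ.1) b))

/-- Move the bridges from copy `1` to copy `2`. [this work] -/
def bmap (κ : St V) : St V := (κ.1, κ.2.1 \ Br a b X M κ, κ.2.2 ∪ Br a b X M κ)

/-- The states fixed for the `Φ₃` read table. [this work] -/
def FixG : Finset (St V) := (Asg M).filter (fun κ => ∀ e ∈ M, fixedP uYG uZG X a b κ e)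

/-- The states fixed for the `Φ₄` read table. [this work] -/
def FixH : Finset (St V) := (Asg M).filter (fun κ => ∀ e ∈ M, fixedP uYH uZH X a b κ e)

variable {D a b c X Y Z M}

/-- For a pair outside copy `0` the clusters it sees are those of `X ∪ S₁`. [this work] -/
theorem cA_of_not_mem {κ : St V} {e : Sym2 V} (he : e ∉ κ.1) : cA X a κ e = cl (X ∪ κ.1) a ∧ cB X b κ e = cl (X ∪ κ.1) b := by
  unfold cA cB; rw [erase_eq_of_notMem he]; exact ⟨rfl, rfl⟩

/-- In an `H`-fixed state every bridge sits in copy `1`. [this work] -/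
theorem br_subset_of_fixH {κ : St V} (hκ : κ ∈ FixH a b X M) : Br a b X M κ ⊆ κ.2.1 := by
  intro e he
  obtain ⟨he1, hA, hB⟩ := mem_filter.1 he
  obtain ⟨heM, he0⟩ := mem_sdiff.1 he1
  obtain ⟨-, hfix⟩ := mem_filter.1 hκ
  obtain ⟨-, -, h3⟩ := hfix e heM
  have hc := cA_of_not_mem (X := X) (a := a) (b := b) he0
  have hnb : ¬ nb X a b κ e := fun h => by unfold nb at h; rw [hc.1] at h; exact h.1 hA
  have huy : ¬ uYH (cA X a κ e) (cB X b κ e) e := fun h => by unfold uYH at h; rw [hc.2] at h; exact h.2 hB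
  have huz : uZH (cA X a κ e) (cB X b κ e) e := by unfold uZH; rw [hc.2]; exact hB
  exact (h3 hnb huy huz).resolve_left he0

/-- The bridge map sends `H`-fixed states to `G`-fixed states. [this work] -/
theorem bmap_mem_fixG {κ : St V} (hκ : κ ∈ FixH a b X M) : bmap a b X M κ ∈ FixG a b X M := by
  have hBr := br_subset_of_fixH hκ
  obtain ⟨hA, hfix⟩ := mem_filter.1 hκ
  obtain ⟨h1, h2, h3, d12, d13, d23⟩ := mem_Asg.1 hA
  have hBrM : Br a b X M κ ⊆ M \ κ.1 := filter_subset _ _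
  refine mem_filter.2 ⟨mem_Asg.2 ⟨h1, sdiff_subset.trans h2, union_subset h3 (hBrM.trans sdiff_subset), ?_, ?_, ?_⟩, fun e heM => ?_⟩
  · exact d12.mono_right sdiff_subset
  · exact disjoint_union_right.2 ⟨d13, disjoint_left.2 fun e he hb => (mem_sdiff.1 (hBrM hb)).2 he⟩
  · exact disjoint_union_right.2 ⟨d23.mono_left sdiff_subset, disjoint_sdiff_self_left⟩
  · -- fixedness for the `Φ₃` table
    obtain ⟨g1, g2, g3⟩ := hfix e heM
    have hcA : cA X a (bmap a b X M κ) e = cA X a κ e := rfl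
    have hcB : cB X b (bmap a b X M κ) e = cB X b κ e := rfl
    unfold fixedP
    rw [show nb X a b (bmap a b X M κ) e ↔ nb X a b κ e from by unfold nb; rw [hcA, hcB], hcA, hcB]
    simp only [bmap, mem_sdiff, mem_union]
    refine ⟨fun hn => ?_, fun hn hy => ?_, fun hn hy hz => ?_⟩
    · rcases g1 hn with hh | hh
      · by_cases hb : e ∈ Br a b X M κ
        · exact Or.inr (Or.inr hb)
        · exact Or.inl ⟨hh, hb⟩
      · exact Or.inr (Or.inl hh)
    · unfold uYG at hy
      by_cases he0 : e ∈ κ.1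
      · exact Or.inl he0
      · have hc := cA_of_not_mem (X := X) (a := a) (b := b) he0
        by_cases hb : e ∈ touch (cB X b κ e)
        · refine Or.inr (Or.inr (mem_filter.2 ⟨mem_sdiff.2 ⟨heM, he0⟩, ?_, ?_⟩))
          · rw [← hc.1]; exact hy
          · rw [← hc.2]; exact hb
        · rcases g2 hn ⟨hy, hb⟩ with hh | hh
          · exact Or.inl hh
          · exact Or.inr (Or.inl hh)
    · unfold uYG at hy; unfold uZG at hz
      have hz' : uZH (cA X a κ e) (cB X b κ e) e := hz
      have hy' : ¬ uYH (cA X a κ e) (cB X b κ e) e := fun hh => hy hh.1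
      rcases g3 hn hy' hz' with hh | hh
      · exact Or.inl hh
      · by_cases he0 : e ∈ κ.1
        · exact Or.inl he0
        · have hc := cA_of_not_mem (X := X) (a := a) (b := b) he0
          refine Or.inr ⟨hh, fun hb => hy ?_⟩
          rw [hc.1]; exact (mem_filter.1 hb).2.1

/-- The bridge map is injective on `H`-fixed states. [this work] -/
theorem bmap_injOn : Set.InjOn (bmap a b X M) ↑(FixH a b X M) := by
  intro κ hκ μ hμ h
  have hκB := br_subset_of_fixH (mem_coe.1 hκ)
  have hμB := br_subset_of_fixH (mem_coe.1 hμ)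
  obtain ⟨-, -, -, -, -, dκ⟩ := mem_Asg.1 (mem_filter.1 (mem_coe.1 hκ)).1
  obtain ⟨-, -, -, -, -, dμ⟩ := mem_Asg.1 (mem_filter.1 (mem_coe.1 hμ)).1
  unfold bmap at h
  simp only [Prod.mk.injEq] at h
  obtain ⟨h1, h2, h3⟩ := h
  have hB : Br a b X M κ = Br a b X M μ := by unfold Br; rw [h1]
  rw [hB] at h2 h3 hκB
  have e2 : κ.2.1 = μ.2.1 := by rw [← sdiff_union_of_subset hκB, ← sdiff_union_of_subset hμB, h2]
  have e3 : κ.2.2 = μ.2.2 := by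
    have dκ' : Disjoint κ.2.2 (Br a b X M μ) := (dκ.mono_left hκB).symm
    have dμ' : Disjoint μ.2.2 (Br a b X M μ) := (dμ.mono_left hμB).symm
    rw [← union_sdiff_cancel_right dκ', ← union_sdiff_cancel_right dμ', h3]
  exact Prod.ext h1 (Prod.ext e2 e3)

/-- The `λ₄`-weight of a state is at most the `λ₃`-weight of its bridge image (Lemma 2, then monotonicity of `λ₃` in `o₃`). [this work] -/
theorem vH_le_vG_bmap (hMY : ∀ e ∈ M, e ∉ Y) (κ : St V) (hD : X ∪ κ.1 ⊆ D) :
    vH a b c X Y Z κ ≤ vG D a b c X Y Z (bmap a b X M κ) := by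
  have hx0 : trip X Y Z κ 0 ⊆ D := by unfold trip; simpa using hD
  have step1 := gqH_le_gqG D a b c (trip X Y Z κ) hx0
  unfold vH vG
  refine step1.trans ?_
  rw [(phi3_trip κ).1, (phi3_trip κ).2, (phi3_trip (bmap a b X M κ)).1, (phi3_trip (bmap a b X M κ)).2]
  simp only [bmap]
  have hBrA : Br a b X M κ ⊆ touch (cl (X ∪ κ.1) a) := fun e he => (mem_filter.1 he).2.1
  have hY : Y ∪ (κ.2.1 \ Br a b X M κ) = (Y ∪ κ.2.1) \ Br a b X M κ := by
    ext f; simp only [mem_union, mem_sdiff]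
    constructor
    · rintro (h | ⟨h, hn⟩)
      · exact ⟨Or.inl h, fun hb => hMY f (mem_sdiff.1 (mem_filter.1 hb).1).1 h⟩
      · exact ⟨Or.inr h, hn⟩
    · rintro ⟨h | h, hn⟩
      · exact Or.inl h
      · exact Or.inr ⟨h, hn⟩
  rw [hY, splice_sdiff_right_of_subset hBrA, ← union_assoc,
    splice_union_right_of_disjoint (fun i hi hF => (mem_sdiff.1 hF).2 (hBrA hi))]
  exact gqG_le_union D a b c _ _ _

/-- **COMPLETE MONOTONICITY of the Γ-certificate** (GAMMA-COMB-THEOREM.md, Theorem §2): for every support `D`, base `(X,Y,Z)` with `X ⊆ D`, and every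
set `M ⊆ D` of pairs closed in all three copies, `Σ_{κ ∈ Asg M} sgn κ · (−gcert)(X ∪ κ₁, Y ∪ κ₂, Z ∪ κ₃) ≥ 0`.  At diagonal bases these signed sums are the
tensor-Bernstein coefficients (weight-free interval splits) of `Γ`, so `Γ` is COMB-POSITIVE. [this work] -/
theorem gcert_complete_monotone (hX : X ⊆ D) (hM : M ⊆ D) (hMX : ∀ e ∈ M, e ∉ X) (hMY : ∀ e ∈ M, e ∉ Y) (hMZ : ∀ e ∈ M, e ∉ Z) :
    0 ≤ ∑ κ ∈ Asg M, sgn M κ * (- gcert D a b c (trip X Y Z κ)) := by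
  have hsplit : ∀ κ : St V, - gcert D a b c (trip X Y Z κ) = vG D a b c X Y Z κ - vH a b c X Y Z κ := by
    intro κ; rw [gcert_eq_gq, gq_eq_sub]; unfold vG vH; ring
  simp_rw [hsplit, mul_sub]
  rw [sum_sub_distrib,
    sum_sgn_eq_sum_fixed (uY := uYG) (uZ := uZG) hMX (vG D a b c X Y Z) (fun κ hκ e he h => vG_tog hMX hMY hMZ κ hκ e he h),
    sum_sgn_eq_sum_fixed (uY := uYH) (uZ := uZH) hMX (vH a b c X Y Z) (fun κ hκ e he h => vH_tog hMX hMY hMZ κ hκ e he h)]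
  have hG : ∑ κ ∈ FixG a b X M, sgn M κ * vG D a b c X Y Z κ = ∑ κ ∈ FixG a b X M, vG D a b c X Y Z κ :=
    sum_congr rfl fun κ hκ => by rw [sgn_eq_one_of_fixed (fun A B e => by unfold uYG uZG; tauto) κ (mem_filter.1 hκ).2, one_mul]
  have hH : ∑ κ ∈ FixH a b X M, sgn M κ * vH a b c X Y Z κ = ∑ κ ∈ FixH a b X M, vH a b c X Y Z κ :=
    sum_congr rfl fun κ hκ => by rw [sgn_eq_one_of_fixed (fun A B e => by unfold uYH uZH; tauto) κ (mem_filter.1 hκ).2, one_mul]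
  change 0 ≤ ∑ κ ∈ FixG a b X M, sgn M κ * vG D a b c X Y Z κ - ∑ κ ∈ FixH a b X M, sgn M κ * vH a b c X Y Z κ
  rw [hG, hH, sub_nonneg]
  calc ∑ κ ∈ FixH a b X M, vH a b c X Y Z κ
      ≤ ∑ κ ∈ FixH a b X M, vG D a b c X Y Z (bmap a b X M κ) :=
        sum_le_sum fun κ hκ => vH_le_vG_bmap hMY κ (union_subset hX ((mem_Asg.1 (mem_filter.1 hκ).1).1.trans hM))
    _ = ∑ μ ∈ (FixH a b X M).image (bmap a b X M), vG D a b c X Y Z μ := (sum_image bmap_injOn).symm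
    _ ≤ ∑ μ ∈ FixG a b X M, vG D a b c X Y Z μ :=
        sum_le_sum_of_subset_of_nonneg (fun μ hμ => by
          obtain ⟨κ, hκ, rfl⟩ := mem_image.1 hμ; exact bmap_mem_fixG hκ)
          (fun μ _ _ => gqG_nonneg D a b c _ _)

end Final

end ThreePointGamma

end Summit.CriticalPhenomena.PercolationContinuityZ3.Theorems

end
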